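import Summits.ResolutionOfSingularities.ResolutionOfSingularities.Theorems.FrobeniusClosingSteerCriticalSquareUpgrade
import Summits.ResolutionOfSingularities.ResolutionOfSingularities.Theorems.FrobeniusClosingSteerRadicandSingularCriterion
import Summits.ResolutionOfSingularities.ResolutionOfSingularities.Theorems.FrobeniusClosingSteerAutoPermissibleTwo
import Literature.AlgebraicGeometry.Resolution.RegularLocalRingsProofs
import HarnessLib

/-!
# D3a part 7: (T3) hygiene upstairs — the radicand is not a square modulo the critical prime when the torsor is regular there
(res-D-pv-012 AS res-L0-w41-stub-8; W4.1 crux `Steer`, LOW branch, strat-2 §σ2.24 `IsLowTowerTwo` clause (T3); wires res-type-072's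
square upgrade (Σ↑) `CriticalSurface.exists_sub_sq_mem_sq_atPrime_of_mem_map_sup` and res-type-082's criterion
`RadicandSingular.not_isRegularLocalRing_adjoinRoot_atPrime_iff`.) OURS; AI.

`mul_sq_sub_sq_not_mem_of_regular`: over a regular local ring `R` of characteristic `2`, with `𝔓 = (D₁ f, D₂ f)` prime and the Hessian
determinant of the pair a unit, if the torsor `T² = f` is REGULAR over `𝔓` then `f·v² − u² ∉ 𝔓` for `v ∉ 𝔓` — i.e. `f̄` is not a
square in the residue field `κ(𝔓)`. (Else `f − (u/v)² ∈ 𝔓 R_𝔓`, the square upgrade gives a cleaning into `𝔪_{R_𝔓}²`, and the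
criterion makes the torsor singular at `𝔓`.)
-/

noncomputable section
set_option linter.dupNamespace false

namespace Summit.ResolutionOfSingularities.ResolutionOfSingularities.Theorems.SwitchingDichotomy.LowTower

open IsLocalRing Polynomial
open Literature.AlgebraicGeometry.Resolution

universe u

/-- **(T3) upstairs: `f̄` is not a square in `κ(𝔓)` when `T² = f` is regular over the critical prime `𝔓 = (D₁ f, D₂ f)`.**
[cite: Matsumura1987, Thm. 14.2] [folklore] -/
theorem mul_sq_sub_sq_not_mem_of_regular {R : Type u} [CommRing R] [IsRegularLocalRing R] [CharP R 2]
    (f : R) (D₁ D₂ : Derivation ℤ R R) (hdet : IsUnit (D₁ (D₁ f) * D₂ (D₂ f) - D₁ (D₂ f) * D₂ (D₁ f)))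
    (Q : Ideal R) [Q.IsPrime] (hQ : Q = Ideal.span {D₁ f, D₂ f})
    (hreg : IsRegularLocalRing (AdjoinRoot ((X : (Localization.AtPrime Q)[X]) ^ 2 -
      C (algebraMap R (Localization.AtPrime Q) f))))
    (u v : R) (hv : v ∉ Q) : f * v ^ 2 - u ^ 2 ∉ Q := by
  classical
  intro hmem
  haveI : Fact (Nat.Prime 2) := ⟨Nat.prime_two⟩
  set Lq := Localization.AtPrime Q with hLq
  haveI : IsRegularLocalRing Lq := isRegularLocalRing_localization_atPrime R Q
  haveI : CharP Lq 2 := AutoPermissible.charP_localization_atPrime (S := R) 2 Q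
  have he₁ : D₁ f ∈ Q := hQ ▸ Ideal.subset_span (by simp)
  have he₂ : D₂ f ∈ Q := hQ ▸ Ideal.subset_span (by simp)
  -- `f − (u/v)² ∈ 𝔓 R_𝔓 ⊆ (𝔓 + Q²) R_Q`
  let vu : Q.primeCompl := ⟨v, hv⟩
  have hγ : ∃ γ : Lq, algebraMap R Lq f - γ ^ 2 ∈
      (Ideal.span {D₁ f, D₂ f} ⊔ Q ^ 2).map (algebraMap R Lq) := by
    refine ⟨IsLocalization.mk' Lq u vu, ?_⟩
    have hvunit : IsUnit (algebraMap R Lq v) := IsLocalization.map_units Lq vu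
    obtain ⟨w, hw⟩ := hvunit
    -- `f − (u/v)² = (f v² − u²) · (v⁻¹)²`
    have hmk : IsLocalization.mk' Lq u vu = algebraMap R Lq u * ↑w⁻¹ := by
      rw [IsLocalization.mk'_eq_iff_eq_mul, mul_assoc, show (vu : R) = v from rfl, ← hw, Units.inv_mul, mul_one]
    have hfactor : algebraMap R Lq f - IsLocalization.mk' Lq u vu ^ 2 =
        algebraMap R Lq (f * v ^ 2 - u ^ 2) * (↑w⁻¹) ^ 2 := by
      rw [hmk, map_sub, map_mul, map_pow, map_pow, ← hw]
      have hw1 : (↑w : Lq) * ↑w⁻¹ = 1 := Units.mul_inv w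
      linear_combination (-(algebraMap R Lq f) * ((↑w : Lq) * ↑w⁻¹ + 1)) * hw1
    rw [hfactor]
    refine Ideal.mul_mem_right _ _ (Ideal.mem_map_of_mem _ ?_)
    rw [← hQ]
    exact Ideal.mem_sup_left hmem
  obtain ⟨γ, hγ⟩ := CriticalSurface.exists_sub_sq_mem_sq_atPrime_of_mem_map_sup f D₁ D₂ hdet Q he₁ he₂ hγ
  exact (RadicandSingular.not_isRegularLocalRing_adjoinRoot_atPrime_iff 2 Q f).mpr ⟨γ, hγ⟩ hreg

end Summit.ResolutionOfSingularities.ResolutionOfSingularities.Theorems.SwitchingDichotomy.LowTower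

end
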